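import Summits.BirchSwinnertonDyer.BirchSwinnertonDyer.Theorems.Rank1ResidualJetCarrierAdd
import Summits.BirchSwinnertonDyer.BirchSwinnertonDyer.Theorems.Rank1ResidualJetCarrierMultKit
import Summits.BirchSwinnertonDyer.Rank1Residual.GaloisImage.FrobeniusOrderWitness
import HarnessLib

/-!
# T1 JET (cell `bsd-jet`), bucket B-add (carrier `q = p = 3`, `E` ADDITIVE at `3`, Kodaira IV/IV*,
# `c₃ = 3`): the RECORD KIT — `BSD(E,3)` for a literal integer model from the bucket-B-add certificate
# through `JET.bsdp_of_carrierAddCertificate_level_three_of_frobenius`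

HONEST FRAMING (programme file `BSD-LIT2PART-PROGRAMME-v1.md` §HONESTY, verbatim): «no tranche here
proves BSD; ARM L moves the LITERAL column of an r ≤ 1 census into the kernel-proved-modulo-named-print
column; ARM P changes what «named print» is worth.» THEOREMS ONLY (seat `bsd-jet-pv-2`, session g2;
`--supports stmt-BirchSwinnertonDyer-14418 --as helper`). Companion of `Rank1ResidualJetCarrierMultKit.lean`
(bucket B, multiplicative carrier) and of pv-1's `Rank1ResidualJetCarrierNeKitThree.lean` (bucket A at
`p = 3`), for the 19 224 bucket-B cells whose carrier is an ADDITIVE `3` (`HOME/census-jet/jet_keys_B_classes.tsv`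
4c8599cf93bc5459: Kodaira IV 7 753, IV* 11 471). Everything a record needs is decided in the kernel from
the literal model: support-form Kraus minimality (`X11b.isGloballyMinimal_of_krausCriterion_support`),
ADDITIVE reduction at `3` from `3 ∣ Δ` and `3 ∣ c₄` (Silverman VII.5.1(c); §1
`not_good_and_not_mult_of_intModel`, the prime-indexed form of x11c's `not_semistable_of_intModel`),
`ρ̄_{E,3}` onto from TWO Frobenius witnesses (x11c's criterion
`GaloisImage.hasSurjectiveModNGaloisRep_of_intModel_of_irr_of_order`: an irreducible Frobenius at `ℓ₁`
and a Frobenius of order `3` at `ℓ₂`), and the `3`-adic TOWER from ONE Frobenius witness modulo `9` at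
`ℓ₃` (`WeierstrassCurve.forall_hasSurjectiveModNGaloisRep_three_pow_of_frobenius`, inside
`JET.bsdp_of_carrierAddCertificate_level_three_of_frobenius`) — the tower is NOT automatic at an
additive `3` (Elkies 2006), so the third witness is essential here (pairs of exotic `3`-adic image have
none and keep the tower binder of `JET.bsdp_of_carrierAddCertificate_level`).

* §1 `not_good_and_not_mult_of_intModel` — `p ∣ Δ(E₀)`, `p ∣ c₄(E₀)` ⟹ `¬ good ∧ ¬ multiplicative`
  at `p` (= `Rank1Residual.Addv W p`), for any globally minimal `W` with integral model `E₀`.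
* §2 `bsdp_of_jetRowCarrierAdd_three_of_frobenius` — the row shape.

CONDITIONAL on the READING binder `hJ : JET.JetchevDivisibilityCarrierAdd` (Rank1ResidualJetDefs.lean,
p474620) and every published binder (`hMcU`, `hGZK`, `hKo`, `hrec`, `hD36`, `hlev`); per pair; nothing
about any particular curve is asserted; PARTITION: row D5 `JET@p∣N` bucket B-add (19 224 cells) — 0
moved by this file.

References: [Jetchev2008] Thm. 1.4, Cor. 1.5 (p. 812); [Serre1972] §2.4 Prop. 15; [Mazur1978]
Prop. 6.3 (1); [SilvermanAEC2009] VII.1 Rem. 1.1, VII.5.1(c), VIII.8, C.21 Rem. 21.3; [Kraus1989]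
Prop. 1–2; [Elkies2006] Introduction; [Kato2004Asterisque] (12.5.2); [SerreAbelianLadic1968] IV-23;
[IrelandRosen1990] Prop. 5.1.2; [Miller2011LMS] Def. 1.1.
-/

set_option autoImplicit false

noncomputable section

open scoped Classical

open IsDedekindDomain NumberField Rat.HeightOneSpectrum WeierstrassCurve Literature.NumberTheory.EllipticCurves
  Literature.NumberTheory.EllipticCurves.ModularForms
  Literature.NumberTheory.EllipticCurves.Rank1Residual
  Literature.NumberTheory.EllipticCurves.Rank1Residual.X11RankOneCertificates
  Summit.BirchSwinnertonDyer.BirchSwinnertonDyer.Rank1Residual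
  Summit.BirchSwinnertonDyer.BirchSwinnertonDyer.Rank1Residual.IntModel
  Summit.BirchSwinnertonDyer.BirchSwinnertonDyer.Rank1Residual.X11RankOne
  Summit.BirchSwinnertonDyer.Rank1Residual Summit.BirchSwinnertonDyer.Rank1Residual.X11b

namespace Summit.BirchSwinnertonDyer.Rank1Residual.JET

/-! ### §1 Additive reduction at `p` from the integer model, prime-indexed -/

/-- **`¬ good ∧ ¬ multiplicative` at `p` (i.e. `Rank1Residual.Addv W p`) from the integer model**:
`p ∣ Δ(E₀)` and `p ∣ c₄(E₀)` for the globally minimal `W` with integral model `E₀` give ADDITIVE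
reduction at the place over `p` (Silverman *AEC* VII.5.1(c), tree `hasAdditiveReductionAt_iff_of_isMinimalAt`),
hence neither good nor multiplicative reduction at the prime `p` (the `𝓞 ℚ`-place bridges
`hasGoodReductionAtPrime_iff_hasGoodReductionAt_ringOfIntegers`,
`hasMultiplicativeReductionAtPrime_iff_hasMultiplicativeReductionAt_ringOfIntegers`). The prime-indexed
form of x11c's `IntModel.not_semistable_of_intModel`. [cite: SilvermanAEC2009, VII.5 Prop. 5.1(c)] -/
theorem not_good_and_not_mult_of_intModel {W : WeierstrassCurve ℚ} [W.IsElliptic] [W.IsGloballyMinimal]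
    {E₀ : WeierstrassCurve ℤ} (hI : integralModelInt W = E₀) (p : ℕ) [hp : Fact p.Prime]
    (hΔ : (p : ℤ) ∣ E₀.Δ) (hc₄ : (p : ℤ) ∣ E₀.c₄) :
    ¬ W.HasGoodReductionAtPrime p ∧ ¬ W.HasMultiplicativeReductionAtPrime p := by
  set v : HeightOneSpectrum (𝓞 ℚ) := (primesEquiv (R := 𝓞 ℚ)).symm ⟨p, hp.out⟩ with hvdef
  have hv : primesEquiv v = ⟨p, hp.out⟩ := Equiv.apply_symm_apply _ _
  haveI : Fact (primesEquiv v : ℕ).Prime := ⟨(primesEquiv v).2⟩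
  have hadd : W.HasAdditiveReductionAt v := by
    rw [hasAdditiveReductionAt_iff_of_isMinimalAt (IsGloballyMinimal.isMinimal (W := W) v),
      Δ_eq_cast hI, c₄_eq_cast hI, (valuation_equiv_padicValuation v).lt_one_iff_lt_one,
      (valuation_equiv_padicValuation v).lt_one_iff_lt_one, Rat.padicValuation_cast,
      Rat.padicValuation_cast, Int.padicValuation_lt_one_iff, Int.padicValuation_lt_one_iff, hv]
    exact ⟨hΔ, hc₄⟩
  have key : ∀ q' : Nat.Primes, primesEquiv v = q' →
      (haveI := Fact.mk q'.2;
        ¬ W.HasGoodReductionAtPrime (q' : ℕ) ∧ ¬ W.HasMultiplicativeReductionAtPrime (q' : ℕ)) := by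
    rintro q' rfl
    refine ⟨fun h ↦ hadd.not_hasGoodReductionAt
        ((hasGoodReductionAtPrime_iff_hasGoodReductionAt_ringOfIntegers v W).mp h),
      fun h ↦ hadd.not_hasMultiplicativeReductionAt
        ((hasMultiplicativeReductionAtPrime_iff_hasMultiplicativeReductionAt_ringOfIntegers W v).mp h)⟩
  exact key ⟨p, hp.out⟩ hv

/-! ### §2 The row shape -/

/-- **`BSD(E,3)` for a literal integer model ADDITIVE at `3` from the bucket-B-add certificate (carrier
`3`), image by THREE Frobenius witnesses** (support-form Kraus minimality). Kernel inputs (`decide`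
goals for a record): `Δ ≠ 0`; the support `bad` of `Δ` with the per-prime Kraus test
(⇒ `IsGloballyMinimal`); `3 ∣ Δ`, `3 ∣ c₄` (ADDITIVE at `3`, §1); good primes `ℓ₁, ℓ₂, ℓ₃ ∉ {2, 3}` with
point counts `n₁, n₂, n₃` such that (i) `X² − (ℓ₁ + 1 − n₁)X + ℓ₁` has no root mod `3`, (ii) `ℓ₂ ≡ 1`,
`ℓ₂ + 1 − n₂ ≡ 2 (mod 3)`, `9 ∤ n₂` (⇒ `ρ̄_{E,3}` onto, x11c's criterion), (iii) `ℓ₃ ≡ 2` or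
`5 (mod 9)` and `ℓ₃ + 1 − n₃ ≡ 3` or `6 (mod 9)` (⇒ the `3`-adic tower, Kato (12.5.2) certificate).
Displayed binders: the READING `hJ : JetchevDivisibilityCarrierAdd` and the published `hMcU`, `hGZK`,
`hKo`, `hrec`, `hD36`, `hlev`; the Heegner datum (`K` with `d_K ∉ {−3,−4}`, `N`, `P` non-torsion), the
certificate line `ord_3 [E(K):ℤP] ≤ ord_3 c_3` AT THE CARRIER `3`, `r_an ≤ 1`, `#Ш_an = s` with
`ord_3 s = 0`. Output `BSDp W 3` via `JET.bsdp_of_carrierAddCertificate_level_three_of_frobenius`.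
CONDITIONAL on every binder; per pair. [cite: Jetchev2008, Cor. 1.5 (p. 812)]
[cite: Serre1972, §2.4 Prop. 15] [cite: SerreAbelianLadic1968, Ch. IV §3.4 Lemma 3 (IV-23)]
[cite: Elkies2006, Introduction (p. 1)] [cite: Kraus1989, Prop. 1 and Prop. 2]
[cite: SilvermanAEC2009, VII.1 Remark 1.1, VII.5 Prop. 5.1(c) and C.21 Remark 21.3]
[cite: Miller2011LMS, Def. 1.1] -/
theorem bsdp_of_jetRowCarrierAdd_three_of_frobenius
    (a1 a2 a3 a4 a6 : ℤ)
    (h0 : discOf [a1, a2, a3, a4, a6] ≠ 0) (bad : List (ℕ × ℕ × ℕ)) (hprime : ∀ t ∈ bad, t.1.Prime)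
    (hsupp : (discOf [a1, a2, a3, a4, a6]).natAbs = (bad.map fun t => t.1 ^ t.2.2).prod)
    (hmin : ∀ t ∈ bad,
      (¬ (t.1 : ℤ) ^ 12 ∣ discOf [a1, a2, a3, a4, a6] ∨ ¬ (t.1 : ℤ) ^ 4 ∣ c4Of [a1, a2, a3, a4, a6]) ∨
      (t.1 = 2 ∧ (16 : ℤ) ∣ c4Of [a1, a2, a3, a4, a6] ∧ (64 : ℤ) ∣ c6Of [a1, a2, a3, a4, a6] ∧
        ¬ (((16 : ℤ) ∣ c4Of [a1, a2, a3, a4, a6] / 16 ∧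
            ((32 : ℤ) ∣ c6Of [a1, a2, a3, a4, a6] / 64 ∨ (32 : ℤ) ∣ c6Of [a1, a2, a3, a4, a6] / 64 - 8)) ∨
          (4 : ℤ) ∣ c6Of [a1, a2, a3, a4, a6] / 64 + 1)) ∨
      (t.1 = 3 ∧ (3 : ℤ) ^ 8 ∣ c6Of [a1, a2, a3, a4, a6] ∧ ¬ (3 : ℤ) ^ 9 ∣ c6Of [a1, a2, a3, a4, a6]))
    (h3Δ : (3 : ℤ) ∣ (⟨a1, a2, a3, a4, a6⟩ : WeierstrassCurve ℤ).Δ)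
    (h3c₄ : (3 : ℤ) ∣ (⟨a1, a2, a3, a4, a6⟩ : WeierstrassCurve ℤ).c₄)
    (ℓ₁ ℓ₂ ℓ₃ : ℕ) (hℓ₁ : ℓ₁.Prime) (hℓ₂ : ℓ₂.Prime) (hℓ₃ : ℓ₃.Prime)
    (h2ℓ₁ : ℓ₁ ≠ 2) (h2ℓ₂ : ℓ₂ ≠ 2) (h2ℓ₃ : ℓ₃ ≠ 2) (h3ℓ₁ : ℓ₁ ≠ 3) (h3ℓ₂ : ℓ₂ ≠ 3)
    (hΔ₁ : ¬ (ℓ₁ : ℤ) ∣ (⟨a1, a2, a3, a4, a6⟩ : WeierstrassCurve ℤ).Δ)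
    (hΔ₂ : ¬ (ℓ₂ : ℤ) ∣ (⟨a1, a2, a3, a4, a6⟩ : WeierstrassCurve ℤ).Δ)
    (hΔ₃ : ¬ (ℓ₃ : ℤ) ∣ (⟨a1, a2, a3, a4, a6⟩ : WeierstrassCurve ℤ).Δ)
    {n₁ n₂ n₃ : ℕ} (hc₁ : countPoints [a1, a2, a3, a4, a6] ℓ₁ = n₁)
    (hc₂ : countPoints [a1, a2, a3, a4, a6] ℓ₂ = n₂) (hc₃ : countPoints [a1, a2, a3, a4, a6] ℓ₃ = n₃)
    (hi : ∀ c : ZMod 3, c ^ 2 - (((ℓ₁ : ℤ) + 1 - n₁ : ℤ) : ZMod 3) * c + ℓ₁ ≠ 0)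
    (hii : (ℓ₂ : ZMod 3) = 1 ∧ (((ℓ₂ : ℤ) + 1 - n₂ : ℤ) : ZMod 3) = 2 ∧ ¬ 9 ∣ n₂)
    (hiii : (ℓ₃ % 9 = 2 ∨ ℓ₃ % 9 = 5) ∧
      (((ℓ₃ : ℤ) + 1 - n₃) % 9 = 3 ∨ ((ℓ₃ : ℤ) + 1 - n₃) % 9 = 6))
    (hJ : JetchevDivisibilityCarrierAdd)
    (hMcU : McCallum1991_padicValNat_card_sha_primary_add_le_of_globalDivisibility)
    (hGZK : rank_eq_analyticRank_of_analyticRank_le_one)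
    (hKo : ∀ (N : ℕ) [NeZero N] (W : WeierstrassCurve ℚ) (K : Type) [Field K] [NumberField K],
      kolyvagin N W K)
    (hrec : ∀ (N : ℕ) [NeZero N] (W : WeierstrassCurve ℚ) (K : Type) [Field K] [NumberField K],
      heegnerPointOfConductor_one_galoisConj N W K)
    (hD36 : ∀ (N : ℕ) [NeZero N] (W : WeierstrassCurve ℚ) (K : Type) [Field K] [NumberField K],
      phi_heegnerTau_mem_singularModuliField N W K)
    (hlev : ∀ {N : ℕ} [NeZero N], IsNewformOf.level_eq_conductorNorm (N := N))
    (W : WeierstrassCurve ℚ) (hW : W = ⟨a1, a2, a3, a4, a6⟩)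
    {N : ℕ} [NeZero N] {K : Type} [Field K] [NumberField K] (hK : IsImaginaryQuadratic K)
    (hD3 : NumberField.discr K ≠ -3) (hD4 : NumberField.discr K ≠ -4)
    (hH : SatisfiesHeegnerHypothesis N K) {P : (W.baseChange K).toAffine.Point}
    (hP : IsHeegnerPoint N W K P) (hnt : ¬ IsOfFinAddOrder P)
    (hI : padicValNat 3 (AddSubgroup.zmultiples P).index ≤
      padicValNat 3 ((W.baseChange ℚ_[3]).localTamagawaNumber ℤ_[3]))
    (hr : W.analyticRank ≤ 1) {s : ℚ} (hs : shaAn W = (s : ℂ)) (hv : padicValRat 3 s = 0) :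
    BSDp W 3 := by
  subst hW
  haveI hE : (⟨a1, a2, a3, a4, a6⟩ : WeierstrassCurve ℚ).IsElliptic :=
    X11b.isElliptic_of_discOf_ne_zero a1 a2 a3 a4 a6 h0
  haveI hM : (⟨a1, a2, a3, a4, a6⟩ : WeierstrassCurve ℚ).IsGloballyMinimal :=
    X11b.isGloballyMinimal_of_krausCriterion_support a1 a2 a3 a4 a6 bad hprime hsupp hmin
  haveI := Fact.mk hℓ₁; haveI := Fact.mk hℓ₂; haveI := Fact.mk hℓ₃
  have hI0 : integralModelInt (⟨a1, a2, a3, a4, a6⟩ : WeierstrassCurve ℚ) = ⟨a1, a2, a3, a4, a6⟩ :=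
    integralModelInt_eq_of_map_eq _ (map_mk_int a1 a2 a3 a4 a6)
  -- the three witness counts in `Nat.card` form
  have hn₁ : Nat.card (((⟨a1, a2, a3, a4, a6⟩ : WeierstrassCurve ℤ).map
      (Int.castRingHom (ZMod ℓ₁))).toAffine.Point) = n₁ := by
    exact_mod_cast (X11b.natCard_point_eq_countPoints a1 a2 a3 a4 a6 ℓ₁ h2ℓ₁ hΔ₁).trans hc₁
  have hn₂ : Nat.card (((⟨a1, a2, a3, a4, a6⟩ : WeierstrassCurve ℤ).map
      (Int.castRingHom (ZMod ℓ₂))).toAffine.Point) = n₂ := by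
    exact_mod_cast (X11b.natCard_point_eq_countPoints a1 a2 a3 a4 a6 ℓ₂ h2ℓ₂ hΔ₂).trans hc₂
  have hn₃ : Nat.card (((⟨a1, a2, a3, a4, a6⟩ : WeierstrassCurve ℤ).map
      (Int.castRingHom (ZMod ℓ₃))).toAffine.Point) = n₃ := by
    exact_mod_cast (X11b.natCard_point_eq_countPoints a1 a2 a3 a4 a6 ℓ₃ h2ℓ₃ hΔ₃).trans hc₃
  -- additive at `3`
  obtain ⟨hng, hnm⟩ := not_good_and_not_mult_of_intModel hI0 3 h3Δ h3c₄
  -- `ρ̄_{E,3}` onto: irreducible Frobenius at `ℓ₁`, Frobenius of order `3` at `ℓ₂`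
  have hsurj : (⟨a1, a2, a3, a4, a6⟩ : WeierstrassCurve ℚ).HasSurjectiveModNGaloisRep 3 :=
    GaloisImage.hasSurjectiveModNGaloisRep_of_intModel_of_irr_of_order hI0 3 ℓ₁ ℓ₂ h3ℓ₁ h3ℓ₂ hΔ₁
      hΔ₂ hn₁ hn₂ hi hii.1 hii.2.1 (by norm_num; exact hii.2.2)
  -- the mod-`9` witness at `ℓ₃`: good reduction and `a_{ℓ₃} = ℓ₃ + 1 − n₃`
  have hgood₃ : (⟨a1, a2, a3, a4, a6⟩ : WeierstrassCurve ℚ).HasGoodReductionAtPrime ℓ₃ :=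
    hasGoodReductionAtPrime_of_not_dvd _ ℓ₃ (by rw [minimalDiscriminantInt_eq hI0]; exact hΔ₃)
  have ha9 : (⟨a1, a2, a3, a4, a6⟩ : WeierstrassCurve ℚ).frobeniusTrace ℓ₃ % 9 = 3 ∨
      (⟨a1, a2, a3, a4, a6⟩ : WeierstrassCurve ℚ).frobeniusTrace ℓ₃ % 9 = 6 := by
    rw [frobeniusTrace_eq hI0 hn₃]; exact hiii.2
  exact bsdp_of_carrierAddCertificate_level_three_of_frobenius hJ hMcU hGZK hKo hrec hD36 hlev _ hK
    hD3 hD4 hH hP hnt hng hnm hsurj ℓ₃ hgood₃ hiii.1 ha9 hI hr hs hv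

end Summit.BirchSwinnertonDyer.Rank1Residual.JET

end
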